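import Literature.MathematicalPhysics.QuantumManyBody.GroundStateFeynmanKacEnergyLower
import Mathlib.Analysis.SpecialFunctions.Log.Basic
import HarnessLib

/-!
# Route `BECCutLineWeakDisorder`, crux `GroundStateRigidity` (stmt-AtomisticToContinuum-9072),
# line `Sketch`: the registered stub `stub_fkJensen`

Supports (does not close) stmt-AtomisticToContinuum-9072. **Feynman–Kac Jensen inequality on the
`C¹` Dirichlet core.** For a measurable bounded pair profile `v`, `L > 0`, and a real `C¹` function
`f` on `(ℝ³)^N` vanishing off the open box `Λ = Λ_L^N`,
`‖f‖₂² · exp(−𝓔(f)/‖f‖₂²) ≤ ⟨f, e^{−H_N} f⟩_{L²(Λ)} = ∫_Λ f · T_1 f` with `𝓔(f) = ∫|∇f|² + ∫ V f²`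
(`realKinetic`, `interaction`) and `T_t = e^{−tH_N}` the Feynman–Kac semigroup (`fkReal`, `fkL2` of
`GroundStateFeynmanKacOperator`). This is Jensen's inequality for the spectral measure of `f`,
proved without spectral theory (Chung–Zhao (1995), Prop 3.29), from four ingredients:

* `exp_neg_mul_div_le_one_sub_pow` — `e^{−m b/(1−b)} ≤ (1 − b)^m` (`b < 1`);
* `exp_neg_le_of_sq_le` — if `r(n+1)² ≤ r n` and `1 − 2^{−n} bₙ ≤ r n` with `bₙ → B` then
  `e^{−B} ≤ r 0` (iterate to `r n^{2^n} ≤ r 0` and let `n → ∞`);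
* `setIntegral_mul_fkReal_sq_le` — **log-convexity** of `t ↦ P(t) = ∫_Λ f·T_t f`:
  `0 ≤ P(s)` and `P(s)² ≤ P(2s) ∫_Λ f²` (`⟨T_{2s} f, f⟩ = ‖T_s f‖²` by the semigroup law and
  symmetry, then Cauchy–Schwarz);
* `sub_setIntegral_mul_fkReal_le` — the **small-time bound**
  `∫f² − P(t) ≤ t ∫|∇f|² + K_t(f) + J_t(f)` with the exit term `K_t` and the interaction term `J_t`
  of `GroundStateFeynmanKacEnergyLower` (square identity, the `C¹` bound
  `sqIncr t f ≤ 2t∫|∇f|²`, and `pairing_shift_sub_fkReal_le`), plus finiteness of `∫|∇f|²` and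
  `∫Vf²` for such `f`.

Then `stub_fkJensen`: the ratios `rₙ = P(2^{−n})/‖f‖²` obey `rₙ₊₁² ≤ rₙ` and `rₙ ≥ 1 − 2^{−n} bₙ`
with `bₙ = (∫|∇f|² + (K + J)_{2^{−n}}/2^{−n})/‖f‖² → 𝓔(f)/‖f‖²` (`K_t/t → 0` by `lintegral_exit_le`,
`J_t/t → ∫Vf²` by `tendsto_interactionTerm_div`), so `r₀ = P(1)/‖f‖² ≥ e^{−𝓔(f)/‖f‖²}`. The
degenerate case `‖f‖₂ = 0` is `0 ≤ P(1)` (`x/0 = 0`).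

## References

* K. L. Chung, Z. Zhao, *From Brownian Motion to Schrödinger's Equation* (1995), Thm 3.17,
  Thm 3.27, Prop 3.29 (81). [cite: ChungZhao1995, Prop 3.29]
-/

noncomputable section

open MeasureTheory Filter Set
open scoped ENNReal NNReal Topology InnerProductSpace

namespace Summit.AtomisticToContinuum.BoseEinsteinCondensation.Theorems.GroundStateRigidity

open Literature.MathematicalPhysics.QuantumManyBody.BoseGas

/-! ### Two real-variable lemmas -/

/-- `e^{−m b/(1−b)} ≤ (1 − b)^m` for `b < 1` and `m : ℕ` (from `1 − x⁻¹ ≤ log x` at `x = 1 − b`).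
[folklore] -/
theorem exp_neg_mul_div_le_one_sub_pow (m : ℕ) {b : ℝ} (hb1 : b < 1) :
    Real.exp (-(m * b / (1 - b))) ≤ (1 - b) ^ m := by
  have h1b : 0 < 1 - b := by linarith
  conv_rhs => rw [← Real.exp_log h1b, ← Real.exp_nat_mul]
  refine Real.exp_le_exp.2 ?_
  have hlog : 1 - (1 - b)⁻¹ ≤ Real.log (1 - b) := Real.one_sub_inv_le_log_of_pos h1b
  have heq : -(m * b / (1 - b)) = (m : ℝ) * (1 - (1 - b)⁻¹) := by
    field_simp
    ring
  rw [heq]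
  exact mul_le_mul_of_nonneg_left hlog (Nat.cast_nonneg m)

/-- **Log-convexity iterated along the dyadic times.** If a real sequence satisfies
`r (n+1)² ≤ r n` and `1 − 2^{−n} bₙ ≤ r n` with `bₙ → B`, then `e^{−B} ≤ r 0`: indeed
`r 0 ≥ (r n)^{2^n} ≥ (1 − 2^{−n} bₙ)^{2^n} ≥ exp(−bₙ/(1 − 2^{−n}bₙ)) → e^{−B}`. [folklore] -/
theorem exp_neg_le_of_sq_le {r b : ℕ → ℝ} {B : ℝ} (hsq : ∀ n, r (n + 1) ^ 2 ≤ r n)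
    (hlow : ∀ n, 1 - ((2 : ℝ) ^ n)⁻¹ * b n ≤ r n) (hb : Tendsto b atTop (𝓝 B)) :
    Real.exp (-B) ≤ r 0 := by
  -- iterate: `(r n)^{2^n} ≤ r 0`
  have hpow : ∀ n, r n ^ (2 ^ n) ≤ r 0 := by
    intro n
    induction n with
    | zero => simp
    | succ n ih =>
      calc r (n + 1) ^ 2 ^ (n + 1) = (r (n + 1) ^ 2) ^ 2 ^ n := by rw [← pow_mul, pow_succ' 2 n]
        _ ≤ r n ^ 2 ^ n := pow_le_pow_left₀ (sq_nonneg _) (hsq n) _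
        _ ≤ r 0 := ih
  -- `2^{-n} bₙ → 0`
  have hy : Tendsto (fun n => ((2 : ℝ) ^ n)⁻¹ * b n) atTop (𝓝 0) := by
    have h0 : Tendsto (fun n : ℕ => ((2 : ℝ) ^ n)⁻¹) atTop (𝓝 0) :=
      tendsto_inv_atTop_zero.comp (tendsto_pow_atTop_atTop_of_one_lt one_lt_two)
    simpa using h0.mul hb
  -- the bound at level `n`
  have hkey : ∀ n, ((2 : ℝ) ^ n)⁻¹ * b n < 1 →
      Real.exp (-(b n / (1 - ((2 : ℝ) ^ n)⁻¹ * b n))) ≤ r 0 := by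
    intro n hy1
    have h := exp_neg_mul_div_le_one_sub_pow (2 ^ n) hy1
    have heq : ((2 ^ n : ℕ) : ℝ) * (((2 : ℝ) ^ n)⁻¹ * b n) = b n := by
      push_cast
      rw [← mul_assoc, mul_inv_cancel₀ (pow_ne_zero n two_ne_zero), one_mul]
    rw [heq] at h
    exact h.trans ((pow_le_pow_left₀ (by linarith) (hlow n) _).trans (hpow n))
  -- the limit `n → ∞`
  have hden : Tendsto (fun n => 1 - ((2 : ℝ) ^ n)⁻¹ * b n) atTop (𝓝 1) := by
    simpa using (tendsto_const_nhds (x := (1 : ℝ))).sub hy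
  have hq := hb.div hden one_ne_zero
  rw [div_one] at hq
  have hlim := (Real.continuous_exp.tendsto _).comp hq.neg
  have hev : ∀ᶠ n : ℕ in atTop, ((2 : ℝ) ^ n)⁻¹ * b n < 1 :=
    hy.eventually (eventually_lt_nhds one_pos)
  exact le_of_tendsto hlim (hev.mono fun n hn => hkey n hn)

/-! ### Log-convexity of the pairing `t ↦ ∫_Λ f · T_t f` -/

variable {N : ℕ}

/-- **Log-convexity of the Feynman–Kac pairing.** For bounded measurable `f` and `s > 0`,
`0 ≤ ∫_Λ f·T_s f` and `(∫_Λ f·T_s f)² ≤ (∫_Λ f·T_{2s} f) · ∫_Λ f²`: with `[f] ∈ L²(Λ)` the class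
of `f`, `∫_Λ f·T_t f = ⟪T_t [f], [f]⟫`, `⟪T_{2s}[f], [f]⟫ = ‖T_s [f]‖²` (semigroup law and symmetry,
`inner_fkL2_self_eq_norm_sq`), and `⟪T_s[f], [f]⟫ ≤ ‖T_s[f]‖ ‖[f]‖`.
[cite: ChungZhao1995, Thm 3.17] -/
theorem setIntegral_mul_fkReal_sq_le {v : ℝ → ℝ≥0∞} (hv : Measurable v) (L : ℝ) {s : ℝ}
    (hs : 0 < s) {f : Config N → ℝ} (hf : Measurable f) {M : ℝ} (hM : ∀ x, |f x| ≤ M) :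
    0 ≤ ∫ x in boxN N L, f x * fkReal v L s f x ∧
      (∫ x in boxN N L, f x * fkReal v L s f x) ^ 2 ≤
        (∫ x in boxN N L, f x * fkReal v L (2 * s) f x) * ∫ x in boxN N L, f x ^ 2 := by
  set μ : Measure (Config N) := volume.restrict (boxN N L) with hμ
  haveI : IsFiniteMeasure μ :=
    ⟨by rw [hμ, Measure.restrict_apply_univ]; exact volume_boxN_lt_top N L⟩
  have hmem : MemLp f 2 μ := MemLp.of_bound hf.aestronglyMeasurable M
    (Eventually.of_forall fun x => by rw [Real.norm_eq_abs]; exact hM x)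
  set fL : Lp ℝ 2 μ := hmem.toLp f with hfLdef
  have hfL : (fL : Config N → ℝ) =ᵐ[μ] f := hmem.coeFn_toLp
  have hinner : ∀ {t : ℝ}, 0 < t →
      ⟪fkL2 v L t fL, fL⟫_ℝ = ∫ x in boxN N L, f x * fkReal v L t f x := by
    intro t ht
    rw [L2.inner_def]
    refine integral_congr_ae ?_
    filter_upwards [hfL, fkL2_coeFn hv L ht fL] with x h1 h2
    rw [RCLike.inner_apply, conj_trivial, h2, h1, fkReal_congr_ae_restrict v L ht hfL x]
  have hnorm : ‖fL‖ ^ 2 = ∫ x in boxN N L, f x ^ 2 := by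
    rw [← real_inner_self_eq_norm_sq, L2.inner_def]
    refine integral_congr_ae ?_
    filter_upwards [hfL] with x h1
    rw [RCLike.inner_apply, conj_trivial, h1, sq]
  have h2s : 0 < 2 * s := by positivity
  have hP2 : ∫ x in boxN N L, f x * fkReal v L (2 * s) f x = ‖fkL2 v L s fL‖ ^ 2 := by
    rw [← hinner h2s, inner_fkL2_self_eq_norm_sq hv L h2s, mul_div_cancel_left₀ s two_ne_zero]
  have h0 : 0 ≤ ⟪fkL2 v L s fL, fL⟫_ℝ := inner_fkL2_self_nonneg hv L hs fL
  refine ⟨by rw [← hinner hs]; exact h0, ?_⟩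
  rw [hP2, ← hnorm, ← hinner hs]
  calc ⟪fkL2 v L s fL, fL⟫_ℝ ^ 2 ≤ (‖fkL2 v L s fL‖ * ‖fL‖) ^ 2 :=
        pow_le_pow_left₀ h0 (real_inner_le_norm _ _) 2
    _ = ‖fkL2 v L s fL‖ ^ 2 * ‖fL‖ ^ 2 := mul_pow _ _ _

/-! ### Finiteness of the two energies -/

/-- `∫ |∇f|² < ∞` for a compactly supported `C¹` function (the gradient is bounded and vanishes
off the support). [folklore] -/
theorem lintegral_realKinetic_ne_top {f : Config N → ℝ} (hf1 : ContDiff ℝ 1 f)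
    (hsupp : HasCompactSupport f) : ∫⁻ x, realKinetic f x ≠ ⊤ := by
  obtain ⟨G, hG⟩ := (hf1.continuous_fderiv one_ne_zero).bounded_above_of_compact_support
    (hsupp.fderiv (𝕜 := ℝ))
  have hb : ∀ x, realKinetic f x ≤ (tsupport f).indicator
      (fun _ => ENNReal.ofReal ((3 * N : ℕ) * G ^ 2)) x := by
    intro x
    by_cases hx : x ∈ tsupport f
    · rw [indicator_of_mem hx, realKinetic_eq_ofReal]
      refine ENNReal.ofReal_le_ofReal ?_
      calc ∑ i, ∑ k, (fderiv ℝ f x (Pi.single i (EuclideanSpace.single k (1 : ℝ)))) ^ 2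
          ≤ ∑ _i : Fin N, ∑ _k : Fin 3, G ^ 2 := by
            refine Finset.sum_le_sum fun i _ => Finset.sum_le_sum fun k _ => ?_
            have h := (fderiv ℝ f x).le_opNorm (Pi.single i (EuclideanSpace.single k (1 : ℝ)))
            have hn : ‖(Pi.single i (EuclideanSpace.single k (1 : ℝ)) : Config N)‖ = 1 := by
              rw [Pi.norm_single, PiLp.norm_single, norm_one]
            rw [hn, mul_one, Real.norm_eq_abs] at h
            have hab := abs_le.1 (h.trans (hG x))
            nlinarith [hab.1, hab.2]
        _ = (3 * N : ℕ) * G ^ 2 := by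
            simp only [Finset.sum_const, Finset.card_univ, Fintype.card_fin, Nat.cast_mul,
              Nat.cast_ofNat]
            ring
    · rw [indicator_of_notMem hx, realKinetic_eq_ofReal, fderiv_of_notMem_tsupport ℝ hx]
      simp
  refine ne_top_of_le_ne_top ?_ (lintegral_mono hb)
  rw [lintegral_indicator hsupp.isClosed.measurableSet, setLIntegral_const]
  exact ENNReal.mul_ne_top ENNReal.ofReal_ne_top (hsupp.measure_lt_top).ne

/-- `∫ V f² < ∞` for a bounded `f` vanishing off the box and a bounded pair profile
(`V ≤ N² C` pointwise). [folklore] -/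
theorem lintegral_interaction_mul_sq_ne_top {v : ℝ → ℝ≥0∞} {C : ℝ≥0} (hC : ∀ r, v r ≤ C)
    (L : ℝ) {f : Config N → ℝ} (hzero : ∀ x, x ∉ boxN N L → f x = 0) {M : ℝ}
    (hM : ∀ x, |f x| ≤ M) : ∫⁻ x, interaction v x * ‖f x‖ₑ ^ 2 ≠ ⊤ := by
  have hM0 : 0 ≤ M := (abs_nonneg _).trans (hM 0)
  have hb : ∀ x, interaction v x * ‖f x‖ₑ ^ 2 ≤ (boxN N L).indicator
      (fun _ => (N * N : ℕ) * C * ENNReal.ofReal (M ^ 2)) x := by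
    intro x
    by_cases hx : x ∈ boxN N L
    · rw [indicator_of_mem hx]
      refine mul_le_mul' (interaction_le_of_le hC x) ?_
      rw [Real.enorm_eq_ofReal_abs, ← ENNReal.ofReal_pow (abs_nonneg _), sq_abs]
      exact ENNReal.ofReal_le_ofReal (by nlinarith [abs_le.1 (hM x), hM0])
    · rw [indicator_of_notMem hx, hzero x hx]; simp
  refine ne_top_of_le_ne_top ?_ (lintegral_mono hb)
  rw [lintegral_indicator (measurableSet_boxN N L), setLIntegral_const]
  exact ENNReal.mul_ne_top (ENNReal.mul_ne_top (ENNReal.mul_ne_top (ENNReal.natCast_ne_top _)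
    ENNReal.coe_ne_top) ENNReal.ofReal_ne_top) (volume_boxN_lt_top N L).ne

/-! ### The small-time bound `∫f² − ⟨f, T_t f⟩ ≤ t∫|∇f|² + K_t + J_t` -/

/-- **The small-time bound on the pairing.** For a real `C¹` function `f` vanishing off the box,
bounded by `M`, square integrable, with `∫|∇f|² < ∞`, and `t > 0`:
`∫ f² − ∫_Λ f·T_t f ≤ t ∫|∇f|² + K_t(f) + J_t(f)`, where
`K_t(f) = ∫dx E[𝟙{τ ≤ t}|f(x)||f(x+√2b_t)|]` is the exit term and
`J_t(f) = ∫|f(x)| E_x[(∫₀ᵗV(B_s)ds)|f(B_t)|]dx` the interaction term (square identity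
`∫f² − ⟨f, P_t f⟩ = ½ sqIncr`, `sqIncr ≤ 2t∫|∇f|²`, and `⟨f, P_t f⟩ − ⟨f, T_t f⟩ ≤ K_t + J_t`).
[cite: ChungZhao1995, Prop 3.29] -/
theorem sub_setIntegral_mul_fkReal_le {v : ℝ → ℝ≥0∞} {C : ℝ≥0} (hv : Measurable v)
    (hC : ∀ r, v r ≤ C) (L : ℝ) {t : ℝ≥0} (ht : 0 < t) {f : Config N → ℝ}
    (hf1 : ContDiff ℝ 1 f) (hzero : ∀ x, x ∉ boxN N L → f x = 0) {M : ℝ} (hM : ∀ x, |f x| ≤ M)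
    (hmem : MemLp f 2 volume) (hKE : ∫⁻ x, realKinetic f x ≠ ⊤) :
    (∫ x, f x ^ 2) - ∫ x in boxN N L, f x * fkReal v L t f x ≤
      (t : ℝ) * (∫⁻ x, realKinetic f x).toReal +
        ((∫⁻ x, ∫⁻ ω, (survives L t x)ᶜ.indicator (1 : PathSpace N → ℝ≥0∞) ω *
            (‖f x‖ₑ * ‖f (x + displacement t ω)‖ₑ) ∂wienerPaths N) +
          ∫⁻ x, ‖f x‖ₑ *
            ∫⁻ ω, pathAction v t x ω * ‖f (worldLine x ω t)‖ₑ ∂wienerPaths N).toReal := by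
  have hmeas : Measurable f := hf1.continuous.measurable
  -- (B) the square identity
  have hB := integral_mul_integral_shift_eq hmeas hmem t
  -- (C) the `C¹` bound
  have hC' : (sqIncr t f).toReal ≤ 2 * (t : ℝ) * (∫⁻ x, realKinetic f x).toReal := by
    have h := sqIncr_le_kinetic hf1 t
    have hfin : ENNReal.ofReal (2 * (t : ℝ)) * (∫⁻ x, realKinetic f x) ≠ ⊤ :=
      ENNReal.mul_ne_top ENNReal.ofReal_ne_top hKE
    have := ENNReal.toReal_mono hfin h
    rwa [ENNReal.toReal_mul, ENNReal.toReal_ofReal (by positivity)] at this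
  -- (D) the difference of the two semigroups
  have hD := pairing_shift_sub_fkReal_le hv hC L ht hmeas hM hzero
  have h2 : (∫ x, f x ^ 2) - ∫ x in boxN N L, f x * fkReal v L t f x =
      ((∫ x, f x ^ 2) - ∫ x, f x * ∫ ω, f (x + displacement t ω) ∂wienerPaths N) +
      ((∫ x, f x * ∫ ω, f (x + displacement t ω) ∂wienerPaths N) -
        ∫ x in boxN N L, f x * fkReal v L t f x) := by ring
  have h3 : (∫ x, f x ^ 2) - ∫ x, f x * ∫ ω, f (x + displacement t ω) ∂wienerPaths N =
      (sqIncr t f).toReal / 2 := by rw [hB]; ring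
  rw [h2, h3]
  have h4 : (sqIncr t f).toReal / 2 ≤ (t : ℝ) * (∫⁻ x, realKinetic f x).toReal := by linarith
  exact add_le_add h4 hD

/-! ### The Jensen inequality -/

/-- **Stub `stub_fkJensen` — Feynman–Kac Jensen inequality on the `C¹` Dirichlet core.** For
measurable bounded `v`, `L > 0`, and a real `C¹` function `f` vanishing off `Λ_L^N`:
`‖f‖₂² · exp(−𝓔(f)/‖f‖₂²) ≤ ∫_Λ f · e^{−H_N} f` with `𝓔(f) = ∫|∇f|² + ∫ V f²` (log-convexity of
`t ↦ ⟨f, e^{−tH}f⟩` iterated along `t = 2^{−n}` and the small-time bound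
`‖f‖² − ⟨f, e^{−tH}f⟩ ≤ t∫|∇f|² + K_t + J_t`, `K_t = o(t)`, `J_t/t → ∫Vf²`).
[cite: ChungZhao1995, Prop 3.29] -/
theorem stub_fkJensen :
    ∀ (N : ℕ) (v : ℝ → ℝ≥0∞) (C : ℝ≥0) (L : ℝ), Measurable v → (∀ r, v r ≤ C) → 0 < L →
      ∀ f : Config N → ℝ, ContDiff ℝ 1 f → (∀ X, X ∉ boxN N L → f X = 0) →
        (∫ X, f X ^ 2) * Real.exp (-(((∫⁻ X, realKinetic f X).toReal +
            (∫⁻ X, interaction v X * ‖f X‖ₑ ^ 2).toReal) / ∫ X, f X ^ 2)) ≤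
          ∫ X in boxN N L, f X * fkReal v L 1 f X := by
  intro N v C L hv hC hL f hf1 hzero
  -- basic properties of `f`
  have hcont : Continuous f := hf1.continuous
  have hmeas : Measurable f := hcont.measurable
  have hsupp : HasCompactSupport f :=
    HasCompactSupport.intro' (isBounded_boxN N L).isCompact_closure isClosed_closure
      fun x hx => hzero x fun h => hx (subset_closure h)
  obtain ⟨M, hM⟩ := hcont.bounded_above_of_compact_support hsupp
  have hM' : ∀ x, |f x| ≤ M := fun x => by rw [← Real.norm_eq_abs]; exact hM x
  obtain ⟨G, hG⟩ := (hf1.continuous_fderiv one_ne_zero).bounded_above_of_compact_support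
    (hsupp.fderiv (𝕜 := ℝ))
  have hG0 : 0 ≤ G := le_trans (norm_nonneg (fderiv ℝ f 0)) (hG 0)
  have hLip : ∀ y z, |f y - f z| ≤ G * ‖y - z‖ := fun y z => by
    rw [← Real.norm_eq_abs]
    exact Convex.norm_image_sub_le_of_norm_fderiv_le (𝕜 := ℝ)
      (fun w _ => hf1.differentiable one_ne_zero w) (fun w _ => hG w) convex_univ
      (mem_univ z) (mem_univ y)
  have hmem : MemLp f 2 volume := hcont.memLp_of_hasCompactSupport hsupp
  -- the energies
  set KE : ℝ≥0∞ := ∫⁻ x, realKinetic f x with hKEdef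
  have hKE_top : KE ≠ ⊤ := lintegral_realKinetic_ne_top hf1 hsupp
  set I : ℝ≥0∞ := ∫⁻ x, interaction v x * ‖f x‖ₑ ^ 2 with hIdef
  have hI_top : I ≠ ⊤ := lintegral_interaction_mul_sq_ne_top hC L hzero hM'
  -- `‖f‖²` over the whole space and over the box
  set n2 : ℝ := ∫ x, f x ^ 2 with hn2
  have hn2box : ∫ x in boxN N L, f x ^ 2 = n2 :=
    setIntegral_eq_integral_of_forall_compl_eq_zero fun x hx => by rw [hzero x hx]; ring
  have hn2_nn : 0 ≤ n2 := integral_nonneg fun x => sq_nonneg _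
  -- the degenerate case `‖f‖ = 0`: the pairing is nonnegative
  rcases eq_or_lt_of_le hn2_nn with h0 | hn2pos
  · rw [← h0, zero_mul]
    exact (setIntegral_mul_fkReal_sq_le hv L one_pos hmeas hM').1
  have hn2ne : n2 ≠ 0 := hn2pos.ne'
  -- the dyadic times
  set tN : ℕ → ℝ≥0 := fun n => ((2 : ℝ≥0) ^ n)⁻¹ with htN
  have htpos : ∀ n, 0 < tN n := fun n => by simp only [htN]; positivity
  have htR : ∀ n, ((tN n : ℝ≥0) : ℝ) = ((2 : ℝ) ^ n)⁻¹ := fun n => by simp [htN]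
  have htlim : Tendsto (fun n => ((tN n : ℝ≥0) : ℝ)) atTop (𝓝 0) := by
    have h : (fun n => ((tN n : ℝ≥0) : ℝ)) = fun n => ((2 : ℝ) ^ n)⁻¹ := funext htR
    rw [h]
    exact tendsto_inv_atTop_zero.comp (tendsto_pow_atTop_atTop_of_one_lt one_lt_two)
  -- the exit term `K`, the interaction term `J`, the coefficients `aₙ = ∫|∇f|² + (Kₙ + Jₙ)/tₙ`
  set K : ℕ → ℝ≥0∞ := fun n => ∫⁻ x, ∫⁻ ω, (survives L (tN n) x)ᶜ.indicator
      (1 : PathSpace N → ℝ≥0∞) ω * (‖f x‖ₑ * ‖f (x + displacement (tN n) ω)‖ₑ) ∂wienerPaths N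
    with hKdef
  set J : ℕ → ℝ≥0∞ := fun n => ∫⁻ x, ‖f x‖ₑ * ∫⁻ ω, pathAction v (tN n) x ω *
    ‖f (worldLine x ω (tN n))‖ₑ ∂wienerPaths N with hJdef
  set a : ℕ → ℝ := fun n => KE.toReal + ((K n + J n) / (tN n : ℝ≥0∞)).toReal with hadef
  -- the ratios `rₙ = P(2^{-n}) / ‖f‖²` of the pairing `P(t) = ∫_Λ f · T_t f`
  set r : ℕ → ℝ := fun n => (∫ x in boxN N L, f x * fkReal v L (tN n) f x) / n2 with hrdef
  -- (i) the small-time lower bound `1 - 2^{-n} aₙ/‖f‖² ≤ rₙ`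
  have hlow : ∀ n, 1 - ((2 : ℝ) ^ n)⁻¹ * (a n / n2) ≤ r n := by
    intro n
    have ht0 : (0 : ℝ) < tN n := htpos n
    have h := sub_setIntegral_mul_fkReal_le hv hC L (htpos n) hf1 hzero hM' hmem hKE_top
    have hKJ : (tN n : ℝ) * KE.toReal + (K n + J n).toReal = (tN n : ℝ) * a n := by
      simp only [hadef]
      rw [ENNReal.toReal_div, ENNReal.coe_toReal, mul_add, mul_div_assoc',
        mul_div_cancel_left₀ _ ht0.ne']
    have h' : n2 - ∫ x in boxN N L, f x * fkReal v L (tN n) f x ≤ (tN n : ℝ) * a n := by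
      rw [← hKJ]; exact h
    simp only [hrdef]
    rw [← htR n, le_div_iff₀ hn2pos]
    have he : (1 - (tN n : ℝ) * (a n / n2)) * n2 = n2 - (tN n : ℝ) * a n := by
      rw [sub_mul, one_mul, mul_assoc, div_mul_cancel₀ _ hn2ne]
    rw [he]
    linarith
  -- (ii) log-convexity `rₙ₊₁² ≤ rₙ`
  have hsq : ∀ n, r (n + 1) ^ 2 ≤ r n := by
    intro n
    have ht0 : (0 : ℝ) < tN (n + 1) := htpos (n + 1)
    have h2 : ((tN n : ℝ≥0) : ℝ) = 2 * ((tN (n + 1) : ℝ≥0) : ℝ) := by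
      rw [htR, htR, pow_succ]; field_simp
    obtain ⟨-, h⟩ := setIntegral_mul_fkReal_sq_le hv L ht0 hmeas hM'
    rw [hn2box, ← h2] at h
    simp only [hrdef]
    rw [div_pow, div_le_div_iff₀ (pow_pos hn2pos 2) hn2pos]
    calc (∫ x in boxN N L, f x * fkReal v L (tN (n + 1)) f x) ^ 2 * n2
        ≤ (∫ x in boxN N L, f x * fkReal v L (tN n) f x) * n2 * n2 :=
          mul_le_mul_of_nonneg_right h hn2_nn
      _ = (∫ x in boxN N L, f x * fkReal v L (tN n) f x) * n2 ^ 2 := by ring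
  -- (iii) the coefficients converge: `K_t/t → 0`, `J_t/t → ∫Vf²`
  have hK0 : Tendsto (fun n => K n / (tN n : ℝ≥0∞)) atTop (𝓝 0) := by
    set Cx : ℝ := 792 * Real.sqrt 2 * (N : ℝ) ^ 2 * G ^ 2 * L ^ (3 * N - 1) with hCx
    have hCx0 : 0 ≤ Cx := by positivity
    have hb : ∀ n, K n / (tN n : ℝ≥0∞) ≤ ENNReal.ofReal (Cx * Real.sqrt (tN n)) := by
      intro n
      have h := lintegral_exit_le (N := N) hL.le hzero hLip hG0 (t := tN n) (htpos n).ne'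
      have ht0 : ((tN n : ℝ≥0∞)) ≠ 0 := by exact_mod_cast (htpos n).ne'
      calc K n / (tN n : ℝ≥0∞)
          ≤ ENNReal.ofReal (Cx * ((tN n : ℝ) * Real.sqrt (tN n))) / (tN n : ℝ≥0∞) := by gcongr
        _ = ENNReal.ofReal (Cx * Real.sqrt (tN n)) * (tN n : ℝ≥0∞) / (tN n : ℝ≥0∞) := by
            congr 1
            rw [← ENNReal.ofReal_coe_nnreal, ← ENNReal.ofReal_mul (by positivity)]
            congr 1; ring
        _ = ENNReal.ofReal (Cx * Real.sqrt (tN n)) :=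
            ENNReal.mul_div_cancel_right ht0 ENNReal.coe_ne_top
    have hlim : Tendsto (fun n => ENNReal.ofReal (Cx * Real.sqrt (tN n))) atTop (𝓝 0) := by
      have h2 := ((Real.continuous_sqrt.tendsto 0).comp htlim).const_mul Cx
      simp only [Function.comp_def, Real.sqrt_zero, mul_zero] at h2
      have h3 := ENNReal.tendsto_ofReal h2
      rwa [ENNReal.ofReal_zero] at h3
    exact tendsto_of_tendsto_of_tendsto_of_le_of_le tendsto_const_nhds hlim (fun n => bot_le) hb
  have hJ : Tendsto (fun n => J n / (tN n : ℝ≥0∞)) atTop (𝓝 I) :=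
    (tendsto_interactionTerm_div (N := N) hv hC hcont hsupp).comp tendsto_dyadic_nhdsGT
  have ha : Tendsto a atTop (𝓝 (KE.toReal + I.toReal)) := by
    have h1 : Tendsto (fun n => (K n + J n) / (tN n : ℝ≥0∞)) atTop (𝓝 I) := by
      have := hK0.add hJ
      rw [zero_add] at this
      refine this.congr fun n => ?_
      rw [ENNReal.add_div]
    exact ((ENNReal.tendsto_toReal hI_top).comp h1).const_add KE.toReal
  -- (iv) conclude: `e^{-𝓔(f)/‖f‖²} ≤ r₀ = P(1)/‖f‖²`
  have hfin := exp_neg_le_of_sq_le hsq hlow (ha.div_const n2)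
  have hr0 : r 0 = (∫ x in boxN N L, f x * fkReal v L 1 f x) / n2 := by
    simp only [hrdef]
    have h1 : ((tN 0 : ℝ≥0) : ℝ) = 1 := by rw [htR, pow_zero, inv_one]
    rw [h1]
  rw [hr0, le_div_iff₀ hn2pos] at hfin
  exact (mul_comm _ _).trans_le hfin

end Summit.AtomisticToContinuum.BoseEinsteinCondensation.Theorems.GroundStateRigidity

end
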